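import Mathlib
import Literature.MathematicalPhysics.QuantumFieldTheory.Balaban1983to89.B14InterpolationMeasure

/-!
# `Balaban1983to89.B14Eq326Measure` — [Balaban1988Convergent] (3.26)–(3.27) p. 271 FOR ACTUAL INTEGRALS: the
two-parameter interpolation identity `log Z_{1,1} = ∫₀¹dt ⟨Y⟩_{1,t} + ∫₀¹ds ⟨X⟩_{s,0} + log Z_{0,0}` for
`Z_{s,t} = ∫ w e^{sX+tY} dν`, and the consistency of the measure-theoretic tilt with the finite model of `B14Interpolation`

statement-level skeleton of published theorems with citation tags; proofs where landed; nothing here is a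
claim about the Yang–Mills mass gap

PDF held: `paper:balaban1988-cmp119-convergent-renormalization` (journal page = PDF page + 242; displays (3.26)–(3.27)
read on the x2 render p029 of `run/shared/lean/pub/pub-balaban/b2b-balaban-ref1/pages/1988-cmp119-convergent-renormalization/`).

CITATION HEADER (lean-in-tree rule).  Source: T. Bałaban, *Convergent renormalization expansions for lattice gauge
theories*, Commun. Math. Phys. **119**, 243–285 (1988), doi:10.1007/bf01217741 [Balaban1988Convergent] (cell paper
B14).  Mega-formalization `lit-balaban` (HOME `run/shared/lean/pub/lit-balaban/`), Phase-2 proof seat p27, generation 2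
(unit `lit-balaban-p27`), companion of `B14InterpolationMeasure` (same seat; split for the 400-line rule).  WHAT IS
REPRODUCED: SKELETON rows **B14.Eq3.26** (decl of record `B14.Interpolation.Eq326`, typed over abstract data and proved
there from derivative HYPOTHESES) and **B14.Eq3.27** (the expectations `⟨·⟩_{s,t}`), here for genuine integrals.

THE PRINTED TEXT (verbatim, p. 271 [PDF 29]).  *"Introduce now auxiliary parameters s, t, the parameter t multiplying
the expressions 𝐁_k, A((1/g_k²(·)) − (1/g_k²), …), V^{(k)}, s multiplying 𝐑″_k. We have
  log[z^{(k)} ∫ dA χ^{(k)} exp[−½⟨A, C*Δ^{(k)}CA⟩ − ….]]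
   = ∫₀¹ dt ⟨{𝐁_k(U_k(….)) − 𝐁_k(U_{k+1}) + A(1/g_k²(·) − 1/g_k², U_k(….)) − A(1/g_k²(·) − 1/g_k², U_{k+1})}
       + V^{(k)}(S_{k+1})⟩_{s=1,t}
   + ∫₀¹ ds ⟨{𝐑″_k(U_k(….)) − 𝐑″_k(U_{k+1})}⟩_{s,t=0}
   + log[z^{(k)} ∫ dA χ^{(k)} exp[−½⟨A, C*Δ^{(k)}CA⟩ − ….(s = 0, t = 0)….]].   (3.26)
Here ⟨·⟩_{s,t} denotes the expectation value with respect to the probabilistic measure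
  Z_{s,t}^{−1} dμ_{C^{(k)}(Λ_{k+1})}(A) χ_k exp[−⟨A, C*Δ^{(k)}CA_k⟩ + 𝐏^{(k)} + {….}_{s,t} + tV^{(k)}(S_k)],   (3.27)
where the introduction of the parameters s, t was described above, and Z_{s,t} is the normalization factor."*

WHAT IS TYPED AND PROVED (arbitrary measure space `(Ω, ν)`; in print `ν = dμ_{C^{(k)}(Λ_{k+1})}`).  The parameters enter the
exponent LINEARLY ("t multiplying the expressions …, s multiplying 𝐑″_k"): `S_{s,t} = sX + tY` with `X` = the `𝐑″_k`
difference and `Y` = the braces `{…} + V^{(k)}`, both a.e.-bounded measurable (bounded analytic functions on the domain cut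
out by `χ_k`; the bounds are qualitative binders), reference weight `w = χ_k exp[base]` integrable, `≥ 0` a.e., of positive
integral.  §3: `gibbsFamily_of_affine` (affine exponents satisfy the Gibbs data of `B14InterpolationMeasure` on every
parameter interval), `partFn₂`/`expect₂` (`Z_{s,t}`, `⟨G⟩_{s,t}`), `hasDerivAt_log_partFn₂_t/_s` (`∂_t log Z_{s,t} =
⟨Y⟩_{s,t}`, `∂_s log Z_{s,t} = ⟨X⟩_{s,t}` — (3.27)), and **`eq326_linear : B14.Interpolation.Eq326 (log Z) ⟨Y⟩ ⟨X⟩`** —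
(3.26) along the printed path `(0,0) → (1,0) → (1,1)`, by the row-of-record lemma `B14.Interpolation.eq326_of_hasDerivAt`
whose derivative hypotheses are DISCHARGED by `B14.InterpolationMeasure.GibbsFamily.hasDerivAt_log_partFn`.
§4: for the counting measure on a finite type, `partFn count w (t ↦ tY) t = B14.Interpolation.tiltedSum univ w Y t` and
`⟨Y⟩_t = B14.Interpolation.tiltedExp univ w Y t` — the finite model of the row-of-record file is the special case.
NOT HERE: the identification of `w`, `X`, `Y` with Bałaban's densities (needs the inductive spaces of §2 of the paper).
No `sorry`, no axiom beyond the standard three.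
-/

noncomputable section

open _root_.MeasureTheory _root_.Set _root_.Filter
open scoped Topology ENNReal BigOperators

namespace Literature.MathematicalPhysics.QuantumFieldTheory.Balaban1983to89.B14.Eq326Measure

open B14.InterpolationMeasure

variable {Ω : Type*} [MeasurableSpace Ω]

/-! ## §3a  Affine exponents `S_t = c + tY` satisfy the Gibbs data of (3.27) -/

section Affine

variable {ν : Measure Ω} {w : Ω → ℝ} {S S' : ℝ → Ω → ℝ} {a b : ℝ}


/-- CONSTRUCTOR for an affine exponent `S_t = c + tY` (`c`, `Y` a.e.-bounded and measurable): the Gibbs data of (3.27)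
hold on every parameter interval `(a,b) ⊃ [0,1]`, with `∂_tS_t = Y`. [cite: Balaban1988Convergent, (3.27) p.271] -/
theorem gibbsFamily_of_affine {c Y : Ω → ℝ} (hw_int : Integrable w ν) (hw_nonneg : 0 ≤ᵐ[ν] w) (hw_pos : 0 < ∫ ω, w ω ∂ν)
    (hc : AEStronglyMeasurable c ν) (hY : AEStronglyMeasurable Y ν) {Kc KY : ℝ} (hcb : ∀ᵐ ω ∂ν, |c ω| ≤ Kc)
    (hYb : ∀ᵐ ω ∂ν, |Y ω| ≤ KY) (hS : ∀ t ω, S t ω = c ω + t * Y ω) (hS' : ∀ t ω, S' t ω = Y ω)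
    (ha : a < 0) (hb : 1 < b) : GibbsFamily ν w S S' a b := by
  have hSf : ∀ t, S t = fun ω => c ω + t * Y ω := fun t => funext (hS t)
  have hS'f : ∀ t, S' t = Y := fun t => funext (hS' t)
  refine ⟨ha, hb, hw_int, hw_nonneg, hw_pos, fun t _ => ?_, fun t _ => ?_, ?_, ?_, ?_⟩
  · rw [hSf t]; exact hc.add (hY.const_mul t)
  · rw [hS'f t]; exact hY
  · refine ae_of_all _ fun ω t _ => ?_
    have h1 : (fun t => S t ω) = fun t => c ω + t * Y ω := funext fun t => hS t ω
    rw [h1, hS']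
    exact (((hasDerivAt_id t).mul_const (Y ω)).const_add (c ω)).congr_deriv (by simp)
  · refine ⟨Kc + max |a| |b| * KY, ?_⟩
    filter_upwards [hcb, hYb] with ω hω hω' t ht
    rw [hS]
    have hKY : 0 ≤ KY := (abs_nonneg _).trans hω'
    have ht' : |t| ≤ max |a| |b| := abs_le_max_abs_abs ht.1.le ht.2.le
    calc |c ω + t * Y ω| ≤ |c ω| + |t * Y ω| := abs_add_le _ _
      _ = |c ω| + |t| * |Y ω| := by rw [abs_mul]
      _ ≤ Kc + max |a| |b| * KY := add_le_add hω (mul_le_mul ht' hω' (abs_nonneg _)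
          ((abs_nonneg _).trans ht'))
  · exact ⟨KY, by filter_upwards [hYb] with ω hω t _ using (hS' t ω).symm ▸ hω⟩

end Affine

/-! ## §3b  The two-parameter linear family of (3.26)–(3.27): `Z(s,t) = ∫ w e^{sX + tY} dν` -/

/-- The two-parameter normalization factor `Z_{s,t} = ∫ w e^{sX+tY} dν` of (3.27) (`s` multiplying `X` = "𝐑″_k(U_k(…)) −
𝐑″_k(U_{k+1})", `t` multiplying `Y` = "{𝐁_k … A(…)} + V^{(k)}"). [cite: Balaban1988Convergent, (3.27) p.271] -/
def partFn₂ (ν : Measure Ω) (w X Y : Ω → ℝ) (s t : ℝ) : ℝ := partFn ν w (fun t' ω => s * X ω + t' * Y ω) t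

/-- The two-parameter expectation `⟨G⟩_{s,t}` of (3.27). [cite: Balaban1988Convergent, (3.27) p.271] -/
def expect₂ (ν : Measure Ω) (w X Y G : Ω → ℝ) (s t : ℝ) : ℝ :=
  gibbsExpect ν w (fun t' ω => s * X ω + t' * Y ω) G t

/-- Unfolding: `Z_{s,t} = ∫ w e^{sX+tY} dν`. [cite: Balaban1988Convergent, (3.27) p.271] -/
theorem partFn₂_eq (ν : Measure Ω) (w X Y : Ω → ℝ) (s t : ℝ) :
    partFn₂ ν w X Y s t = ∫ ω, w ω * Real.exp (s * X ω + t * Y ω) ∂ν := rfl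

/-- Unfolding: `⟨G⟩_{s,t} = Z_{s,t}⁻¹ ∫ G w e^{sX+tY} dν` (written as a quotient). [cite: Balaban1988Convergent, (3.27) p.271] -/
theorem expect₂_eq (ν : Measure Ω) (w X Y G : Ω → ℝ) (s t : ℝ) :
    expect₂ ν w X Y G s t = (∫ ω, G ω * (w ω * Real.exp (s * X ω + t * Y ω)) ∂ν) / partFn₂ ν w X Y s t := rfl

section Linear

variable {ν : Measure Ω} {w X Y : Ω → ℝ}

/-- The `t`-slice at fixed `s` is the affine Gibbs family `S_t = sX + tY`, `∂_tS_t = Y`.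
[cite: Balaban1988Convergent, (3.27) p.271] -/
theorem gibbsFamily_slice_t (hw_int : Integrable w ν) (hw_nonneg : 0 ≤ᵐ[ν] w) (hw_pos : 0 < ∫ ω, w ω ∂ν)
    (hX : AEStronglyMeasurable X ν) (hY : AEStronglyMeasurable Y ν) {KX KY : ℝ} (hXb : ∀ᵐ ω ∂ν, |X ω| ≤ KX)
    (hYb : ∀ᵐ ω ∂ν, |Y ω| ≤ KY) (s : ℝ) :
    GibbsFamily ν w (fun t ω => s * X ω + t * Y ω) (fun _ ω => Y ω) (-1) 2 := by
  refine gibbsFamily_of_affine (c := fun ω => s * X ω) (Kc := |s| * KX) hw_int hw_nonneg hw_pos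
    (hX.const_mul s) hY ?_ hYb (fun _ _ => rfl) (fun _ _ => rfl) (by norm_num) (by norm_num)
  filter_upwards [hXb] with ω hω
  rw [abs_mul]; exact mul_le_mul_of_nonneg_left hω (abs_nonneg _)

/-- The `s`-slice at fixed `t` is the affine Gibbs family `S_s = tY + sX`, `∂_sS_s = X`.
[cite: Balaban1988Convergent, (3.27) p.271] -/
theorem gibbsFamily_slice_s (hw_int : Integrable w ν) (hw_nonneg : 0 ≤ᵐ[ν] w) (hw_pos : 0 < ∫ ω, w ω ∂ν)
    (hX : AEStronglyMeasurable X ν) (hY : AEStronglyMeasurable Y ν) {KX KY : ℝ} (hXb : ∀ᵐ ω ∂ν, |X ω| ≤ KX)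
    (hYb : ∀ᵐ ω ∂ν, |Y ω| ≤ KY) (t : ℝ) :
    GibbsFamily ν w (fun s ω => s * X ω + t * Y ω) (fun _ ω => X ω) (-1) 2 := by
  refine gibbsFamily_of_affine (c := fun ω => t * Y ω) (Kc := |t| * KY) hw_int hw_nonneg hw_pos
    (hY.const_mul t) hX ?_ hXb (fun _ _ => by ring) (fun _ _ => rfl) (by norm_num) (by norm_num)
  filter_upwards [hYb] with ω hω
  rw [abs_mul]; exact mul_le_mul_of_nonneg_left hω (abs_nonneg _)

/-- `∂_t log Z_{s,t} = ⟨Y⟩_{s,t}` — (3.27) in the parameter `t`. [cite: Balaban1988Convergent, (3.27) p.271] -/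
theorem hasDerivAt_log_partFn₂_t (hw_int : Integrable w ν) (hw_nonneg : 0 ≤ᵐ[ν] w) (hw_pos : 0 < ∫ ω, w ω ∂ν)
    (hX : AEStronglyMeasurable X ν) (hY : AEStronglyMeasurable Y ν) {KX KY : ℝ} (hXb : ∀ᵐ ω ∂ν, |X ω| ≤ KX)
    (hYb : ∀ᵐ ω ∂ν, |Y ω| ≤ KY) (s : ℝ) {t : ℝ} (ht : t ∈ Ioo (-1:ℝ) 2) :
    HasDerivAt (fun t => Real.log (partFn₂ ν w X Y s t)) (expect₂ ν w X Y Y s t) t :=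
  (gibbsFamily_slice_t hw_int hw_nonneg hw_pos hX hY hXb hYb s).hasDerivAt_log_partFn ht

/-- `∂_s log Z_{s,t} = ⟨X⟩_{s,t}` — (3.27) in the parameter `s`. [cite: Balaban1988Convergent, (3.27) p.271] -/
theorem hasDerivAt_log_partFn₂_s (hw_int : Integrable w ν) (hw_nonneg : 0 ≤ᵐ[ν] w) (hw_pos : 0 < ∫ ω, w ω ∂ν)
    (hX : AEStronglyMeasurable X ν) (hY : AEStronglyMeasurable Y ν) {KX KY : ℝ} (hXb : ∀ᵐ ω ∂ν, |X ω| ≤ KX)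
    (hYb : ∀ᵐ ω ∂ν, |Y ω| ≤ KY) (t : ℝ) {s : ℝ} (hs : s ∈ Ioo (-1:ℝ) 2) :
    HasDerivAt (fun s => Real.log (partFn₂ ν w X Y s t)) (expect₂ ν w X Y X s t) s :=
  (gibbsFamily_slice_s hw_int hw_nonneg hw_pos hX hY hXb hYb t).hasDerivAt_log_partFn hs

/-- **(3.26) WITH (3.27), FOR ACTUAL INTEGRALS**: for `Z_{s,t} = ∫ w e^{sX+tY} dν` with an integrable weight `w ≥ 0` of
positive integral and a.e.-bounded measurable `X`, `Y`,
`log Z_{1,1} = ∫₀¹ dt ⟨Y⟩_{1,t} + ∫₀¹ ds ⟨X⟩_{s,0} + log Z_{0,0}` — the row-of-record display `B14.Interpolation.Eq326`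
along the printed path `(0,0) → (1,0) → (1,1)`, by `B14.Interpolation.eq326_of_hasDerivAt`.
[cite: Balaban1988Convergent, (3.26)–(3.27) p.271] -/
theorem eq326_linear (hw_int : Integrable w ν) (hw_nonneg : 0 ≤ᵐ[ν] w) (hw_pos : 0 < ∫ ω, w ω ∂ν)
    (hX : AEStronglyMeasurable X ν) (hY : AEStronglyMeasurable Y ν) {KX KY : ℝ} (hXb : ∀ᵐ ω ∂ν, |X ω| ≤ KX)
    (hYb : ∀ᵐ ω ∂ν, |Y ω| ≤ KY) :
    B14.Interpolation.Eq326 (fun s t => Real.log (partFn₂ ν w X Y s t)) (fun s t => expect₂ ν w X Y Y s t)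
      (fun s t => expect₂ ν w X Y X s t) := by
  have hsub : uIcc (0:ℝ) 1 ⊆ Ioo (-1:ℝ) 2 := by
    rw [uIcc_of_le zero_le_one]; intro t ht; exact ⟨by linarith [ht.1], by linarith [ht.2]⟩
  refine B14.Interpolation.eq326_of_hasDerivAt _ _ _ (fun t ht => ?_) (fun s hs => ?_) ?_ ?_
  · exact hasDerivAt_log_partFn₂_t hw_int hw_nonneg hw_pos hX hY hXb hYb 1 (hsub ht)
  · exact hasDerivAt_log_partFn₂_s hw_int hw_nonneg hw_pos hX hY hXb hYb 0 (hsub hs)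
  · exact (gibbsFamily_slice_t hw_int hw_nonneg hw_pos hX hY hXb hYb 1).intervalIntegrable_gibbsExpect
  · exact (gibbsFamily_slice_s hw_int hw_nonneg hw_pos hX hY hXb hYb 0).intervalIntegrable_gibbsExpect

end Linear

/-! ## §4  Consistency with the finite model of the row-of-record file `B14Interpolation` -/

section Finite

variable {ι : Type*} [Fintype ι] [MeasurableSpace ι] [MeasurableSingletonClass ι]

/-- For the counting measure on a finite type the normalization factor of the linear tilt `S_t = tY` IS the finite
tilted sum of the row-of-record file: `Z_t = Σ_i w_i e^{tY_i} = B14.Interpolation.tiltedSum univ w Y t`.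
[cite: Balaban1988Convergent, (3.27) p.271] -/
theorem partFn_count_eq_tiltedSum (w Y : ι → ℝ) (t : ℝ) :
    partFn Measure.count w (fun t i => t * Y i) t = B14.Interpolation.tiltedSum Finset.univ w Y t := by
  simp [partFn, gibbsWeight, B14.Interpolation.tiltedSum, integral_count]

/-- … and the tilted expectation IS the finite tilted expectation `B14.Interpolation.tiltedExp univ w Y t`.
[cite: Balaban1988Convergent, (3.27) p.271] -/
theorem gibbsExpect_count_eq_tiltedExp (w Y : ι → ℝ) (t : ℝ) :
    gibbsExpect Measure.count w (fun t i => t * Y i) (fun i => Y i) t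
      = B14.Interpolation.tiltedExp Finset.univ w Y t := by
  simp [gibbsExpect, gibbsNum, partFn, gibbsWeight, B14.Interpolation.tiltedExp, B14.Interpolation.tiltedSum,
    integral_count]

end Finite

end Literature.MathematicalPhysics.QuantumFieldTheory.Balaban1983to89.B14.Eq326Measure
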